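import Summits.HodgeConjecture.HodgeConjecture.Theorems.PadicSemiregularLiftHodgeAbelianVarietiesStubDescend
import Summits.HodgeConjecture.HodgeConjecture.Theorems.PadicSemiregularLiftHodgeAbelianVarietiesStubDescendPrymMultiplicity
import Summits.HodgeConjecture.HodgeConjecture.Theorems.PadicSemiregularLiftHodgeAbelianVarietiesStubDescendPrymSignature
import Summits.HodgeConjecture.HodgeConjecture.Theorems.PadicSemiregularLiftHodgeAbelianVarietiesStubDescendPrymFrameLemmas
import Summits.HodgeConjecture.HodgeConjecture.Theorems.HeckePrymWeilWeilTwelvefoldsSqrtMinus7CmPartnerHalf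
import Summits.HodgeConjecture.HodgeConjecture.Theorems.HeckePrymWeilAimedDescendingIsotropicGlueAll
import Literature.AlgebraicGeometry.HodgeTheory.WeilClassesDescendingTransfer
import Literature.AlgebraicGeometry.HodgeTheory.WeilClassesTestEigenspaces
import Literature.AlgebraicGeometry.HodgeTheory.HodgeRiemannDegreeOneProofs
import Literature.AlgebraicGeometry.HodgeTheory.ComplexConjugationHolds
import Literature.AlgebraicGeometry.Motives.HyperbolicWeilTypeProduct
import Literature.AlgebraicGeometry.Motives.HyperbolicWeilTypeProductModel
import Literature.AlgebraicGeometry.Motives.RationalDegreeOneModel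
import Literature.AlgebraicGeometry.Motives.AbelianVarietyProductDimProofs
import HarnessLib

/-!
# Crux `HodgeAbelianVarieties` (stmt-HodgeConjecture-1333), line `prym-canonical-z3-split-seeds` — stub `stub_descend` PROVED: the partner-surface fact, every `d`, and DESCENDING

The registered stub (gen 3, shared with the e-step line)
`stub_descend : ∀ n d : ℕ, 2 ≤ n → 0 < d → Stubs.WeilAlgebraicSplitHyperplane (n + 1) d → WeilAlgebraicAll n d`
— DESCENDING (C. Schoen, Compositio 114 (1998) §10; K. Koike 2004 Rem. 2.1; E. Markman,
arXiv:2509.23403 §11.5 Step 2): the Weil classes of EVERY Weil-type `2n`-fold `(A, φ)`, `φ ≫ φ = -d`,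
are algebraic as soon as they are on every SPLIT `2(n+1)`-fold — is PROVED here, for all `n ≥ 2`,
`d ≥ 1`, by the landed three-line assembly `Stubs.Descend.stub_descend_of_partner_of_schoen` (p95682) fed
with its two inputs, both now THEOREMS: Schoen's transfer
(`Schoen1998_weilClasses_algebraic_of_prod_surface_all_holds`, tree) and the PARTNER-SURFACE fact
`exists_weilTypeSurface_prod_isHyperbolicWeilType_all` (Markman §11.5 Step 2 with the split criterion of
Step 1; van Geemen LNM 1594 Lemma 5.2, 5.3, 5.4 (5.4.1); Landherr), proved in this file
(`exists_weilTypeSurface_prod_isHyperbolicWeilType_all_holds`) by the product trick of the sibling route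
`HeckePrymWeil` (line `amnesic-secant-sheaves-split-fourteenfolds`, `aimedSplitProduct_seven`, `d = 7`)
carried out for EVERY `d ≥ 1` in the Weil-PLANE typing `weilClassesOf` (parts I–III of this landing:
multiplicities `stub_descend_weilMultiplicity`, signature `stub_descend_weilSignatureOfModel`, models and
Segre `stub_descend_symmetricSegreEmbedding`):

* PARTNER: the CM curve `E = ℂ/(ℤ + ℤ√-d)` with `[√-d]` and its degree-one model, the CM square
  `E × E` with `ψ = ([√-d], -[√-d])` and its descent pair (`exists_cmWeilSurface_descentPair`, every
  `d`, tree), read into the Weil lines of the surface (`eigenspace_le_weilClassesPlus/Minus_two`);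
* AIMING (`aimedFrame_cmSquare`): a real Hodge model of `A`; the `K`-symmetric Segre data; the Weil
  multiplicities `(n, n)` from the Weil-plane class; Hodge–Riemann in degree one for the hyperplane
  class (`hodgeRiemann_degreeOne`, tree THEOREM); the signature `(2n, 2n)` of the rational model; the
  isotropic block vectors (`exists_isotropic_blockVectors'`, Landherr via Meyer) at the binomial weights;
  the weighted Segre embedding; `K`-symmetrisation `= 2d ·`; the product frame
  (`Motives.isHyperbolicWeilType_prod_of_rationalModels`).

No named fact is taken: every input is a theorem of the tree.
-/

-- every declaration of this problem lives in `Summit.HodgeConjecture.HodgeConjecture.…` (single-problem summit)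
set_option linter.dupNamespace false

noncomputable section

open CategoryTheory Complex
open Literature.AlgebraicGeometry Literature.AlgebraicGeometry.Motives
  Literature.AlgebraicGeometry.HodgeTheory Literature.AlgebraicTopology.SingularHomology
open Literature.Geometry.Kaehler
open Summit.HodgeConjecture.HodgeConjecture.Theorems.WeilTwelvefoldsSqrtMinus7.AmnesicSecantSheaves
  (exists_cmWeilSurface_descentPair)

namespace Summit.HodgeConjecture.HodgeConjecture.Cruxes.HodgeAbelianVarieties.PrymCanonicalZ3SplitSeeds.Stubs.Descend

open Summit.HodgeConjecture.HodgeConjecture.Cruxes.HodgeAbelianVarieties.EStepSecantInduction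

/-! ### The aiming half for the CM square, every `d` -/

/-- **The AIMING half of the product trick for the partner `E × E`, every `d ≥ 1`, Weil-plane typing**
(Markman, arXiv:2509.23403 §11.5 Step 2; van Geemen, LNM 1594, Lemma 5.2 (2)–(5), 5.3, 5.4; Schoen 1998
§10): for an elliptic curve `(E, φ)`, `φ ≫ φ = -d`, with an integer model `(x, M)` of `φ^*` on `H¹` and
`x₀ ⌣ x₁ ≠ 0`, and every `(A, φ_A)` of dimension `2n ≥ 2` with `φ_A ≫ φ_A = -d` carrying a non-zero
rational `(n,n)`-class of its Weil plane `weilClassesOf A φ_A n d`, the product `A × (E × E)` with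
`φ_A × (φ, -φ)` has a projective embedding `e` and a rational `a ≠ 0` whose `K`-symmetrised hyperplane
class `d·e^*a + (φ_A × (φ, -φ))^*e^*a` makes it of HYPERBOLIC Weil type in half-dimension `n + 1`.
Proof = the sibling's `stub_aimedFrameOfModel_of` with `7 ↦ d`, its three inputs and Hodge–Riemann in
degree one being theorems (`stub_descend_weilMultiplicity`, `stub_descend_weilSignatureOfModel`,
`stub_descend_symmetricSegreEmbedding`, `hodgeRiemann_degreeOne`).
[cite: Markman2025SurveySecant, §11.5 Step 2] [cite: vanGeemen1994HodgeAV, Lemma 5.2 (2)–(5), 5.3 and 5.4 (5.4.1)]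
[cite: Schoen1998HodgeWeilAddendum, §10] -/
theorem aimedFrame_cmSquare {d : ℕ} (hd : 0 < d) (E : AbelianVariety ℂ) (φ : E ⟶ E) (hE : E.dim = 1)
    (hφ : φ ≫ φ = -(d • 𝟙 E)) (x : Fin 2 → complexBetti E.X 1) (M : Matrix (Fin 2) (Fin 2) ℤ)
    (hxr : ∀ i, IsRationalClass (x i)) (hxi : LinearIndependent ℂ x)
    (hM : ∀ i, complexBetti.map φ.hom.hom.hom 1 (x i) = ∑ j, ((M j i : ℤ) : ℂ) • x j)
    (hω : cupProduct (rfl : 1 + 1 = 2) (x 0) (x 1) ≠ 0)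
    {n : ℕ} {A : AbelianVariety ℂ} {φA : A ⟶ A} (hn : 1 ≤ n) (hA : A.dim = 2 * n)
    (hφA : φA ≫ φA = -(d • 𝟙 A))
    (hweil : ∃ c : complexBetti A.X (2 * n), IsRationalClass c ∧
      IsOfHodgeType (2 * n) A.X (2 * n) n n c ∧ c ∈ weilClassesOf A φA n d ∧ c ≠ 0) :
    ∃ (e : ProjectiveEmbedding (A.prod (E.prod E)).X) (a : complexBetti (projectiveSpace e.n ℂ) 2),
      IsRationalClass a ∧ a ≠ 0 ∧
      IsHyperbolicWeilType (A.prod (E.prod E))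
        (AbelianVariety.prodLift (AbelianVariety.fst A (E.prod E) ≫ φA)
          (AbelianVariety.snd A (E.prod E) ≫
            AbelianVariety.prodLift (AbelianVariety.fst E E ≫ φ) (AbelianVariety.snd E E ≫ (-φ))))
        (n + 1)
        ((d : ℂ) • complexBetti.map e.ι 2 a +
          complexBetti.map (AbelianVariety.prodLift (AbelianVariety.fst A (E.prod E) ≫ φA)
            (AbelianVariety.snd A (E.prod E) ≫
              AbelianVariety.prodLift (AbelianVariety.fst E E ≫ φ)
                (AbelianVariety.snd E E ≫ (-φ)))).hom.hom.hom 2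
            (complexBetti.map e.ι 2 a)) := by
  classical
  -- dimension bookkeeping
  have hA' : A.dim = (2 * n - 1) + 1 := by rw [hA]; omega
  have h2n : (2 * n - 1) + 1 = 2 * n := by omega
  have hE' : E.dim = 0 + 1 := hE
  have hB' : (E.prod E).dim = 1 + 1 := by rw [AbelianVariety.dim_prod, hE]
  have hN : 2 * (n + 1) = (2 * n - 1) + 1 + 2 := by omega
  have hX : IsSmoothProjective ((2 * n - 1) + 1) A.X := isSmoothProjective_of_dim_eq' hA'
  -- (1) a real Hodge model of `A`
  obtain ⟨MH, hMH⟩ := exists_isReal_hodgeModel_holds (2 * n) A.X (isSmoothProjective_of_dim_eq' hA)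
  -- (2) the `K`-symmetric Segre data for `η₀ = x₀ ⌣ x₁`
  obtain ⟨eA, aA, s, haA, haA0, hsym, hemb⟩ := stub_descend_symmetricSegreEmbedding d hd A φA hφA E hE
    (cupProduct (rfl : 1 + 1 = 2) (x 0) (x 1)) ((hxr 0).cup _ (hxr 1)) hω
  have hhAr : IsRationalClass (complexBetti.map eA.ι 2 aA) := haA.map _
  -- (3) multiplicities, the rational model of `(A, φ_A, h_A)`, Hodge–Riemann, the signature
  obtain ⟨hmp, hmm⟩ := stub_descend_weilMultiplicity n d A φA hd hA hφA hweil MH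
  obtain ⟨r, u, MA, ωA, GA, dA, hur, hui, hus, hMA, hωAr, hωA0, hGA, hdA⟩ :=
    exists_rationalModel_one φA hA' (complexBetti.map eA.ι 2 aA) hhAr
  have hHRA : ∀ (MA' : HodgeModel (2 * n) A.X),
      ∃ ω₀ : complexBetti A.X (2 + 2 * (2 * n - 1)), IsRationalClass ω₀ ∧ ω₀ ≠ 0 ∧
        ∀ y : complexBetti A.X 1, MA'.pullback 1 y ∈ MA'.hodgePQ 1 1 0 → y ≠ 0 →
          ∃ t : ℝ, 0 < t ∧
            Complex.I • polarizationPairingOne A.X (complexBetti.map eA.ι 2 aA) (2 * n - 1) y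
              (conjClass (ComplexPoints A.X) 1 y) = (t : ℂ) • ω₀ := by
    rw [← h2n]
    exact fun MA' => hodgeRiemann_degreeOne hX eA haA haA0 MA'
  have hPN := stub_descend_weilSignatureOfModel n d A φA hd hA hφA MH hMH hmp hmm
    (complexBetti.map eA.ι 2 aA) hhAr hsym (hHRA MH) (Fin r) u hur hui hus MA hMA ωA GA hωAr hωA0 hGA
  -- the model is of Weil type and alternating, `M_A² = -d`, on `4n` vectors
  obtain ⟨hWA, hGAt, hMA2, hcard⟩ := afD_weilModel hn hd hA hφA hsym hui hus hMA hωA0 hGA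
  -- (4) the binary partner model and (5) the isotropic block vectors
  obtain ⟨hME2, hGEt, hMx, hnMx, hgram, htop, hsymE⟩ := afD_partnerModel hE hd hφ x hxi M hM
  have hdQ : (0 : ℚ) < d := by exact_mod_cast hd
  obtain ⟨m₁, m₂, hm₁, hm₂, b, hb, hbM, hbG⟩ :=
    Summit.HodgeConjecture.HodgeConjecture.Theorems.exists_isotropic_blockVectors' hdQ
      MA hMA2 GA hGAt hWA n hcard hPN (M.map (Int.cast : ℤ → ℚ)) hME2 !![0, 1; -1, 0] hGEt
      (Pi.single 0 1) (by simp)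
      ((((2 * (n + 1) - 1).choose (2 * n - 1) : ℕ) : ℚ) * (((1 + 1).choose (0 + 1) : ℕ) : ℚ) * s * s)
      ((((2 * (n + 1) - 1).choose (2 * n - 1 + 1) : ℕ) : ℚ) * dA * s)
  -- (6) the embedding at these weights
  obtain ⟨e, a, ha, ha0, he⟩ := hemb m₁ m₂ hm₁ hm₂
  refine ⟨e, a, ha, ha0, ?_⟩
  -- (7) `e^*a = pr_A^* h_A + pr_B^* h_B` and its `K`-symmetrisation `2d · e^*a`
  have he' : complexBetti.map e.ι 2 a =
      complexBetti.map (AbelianVariety.fst A (E.prod E)).hom.hom.hom 2 (complexBetti.map eA.ι 2 aA) +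
        complexBetti.map (AbelianVariety.snd A (E.prod E)).hom.hom.hom 2
          (complexBetti.map (AbelianVariety.fst E E).hom.hom.hom 2
              ((((s * m₁ : ℚ)) : ℂ) • cupProduct (rfl : 1 + 1 = 2) (x 0) (x 1)) +
            complexBetti.map (AbelianVariety.snd E E).hom.hom.hom 2
              ((((s * m₂ : ℚ)) : ℂ) • cupProduct (rfl : 1 + 1 = 2) (x 0) (x 1))) := by
    rw [he]
    congr 1
    simp only [map_add, map_smul, smul_add, smul_smul]
    push_cast
    rfl
  have hΨ := afD_product_symm (d := d) φA _ hsym (hsymE (((s * m₁ : ℚ)) : ℂ) (((s * m₂ : ℚ)) : ℂ))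
  have h2d : ((d : ℂ) + (d : ℂ)) ≠ 0 := by
    rw [← Nat.cast_add, Nat.cast_ne_zero]; omega
  rw [he', hΨ, ← add_smul, isHyperbolicWeilType_smul_iff h2d]
  -- (8) the product frame from the two rational models and the block vectors
  have hGB := polarizationPairingOne_sumElim hE' hE' (m := 1) rfl x x
    ((((s * m₁ : ℚ)) : ℂ) • cupProduct (rfl : 1 + 1 = 2) (x 0) (x 1)) (cupProduct (rfl : 1 + 1 = 2) (x 0) (x 1))
    _ (hgram _) (s * m₁) (htop _)
    ((((s * m₂ : ℚ)) : ℂ) • cupProduct (rfl : 1 + 1 = 2) (x 0) (x 1)) (cupProduct (rfl : 1 + 1 = 2) (x 0) (x 1))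
    _ (hgram _) (s * m₂) (htop _)
  have hdB := lefschetzPow_add_map_self hE' hE' (m := 1) rfl
    ((((s * m₁ : ℚ)) : ℂ) • cupProduct (rfl : 1 + 1 = 2) (x 0) (x 1)) (cupProduct (rfl : 1 + 1 = 2) (x 0) (x 1))
    (s * m₁) (htop _)
    ((((s * m₂ : ℚ)) : ℂ) • cupProduct (rfl : 1 + 1 = 2) (x 0) (x 1)) (cupProduct (rfl : 1 + 1 = 2) (x 0) (x 1))
    (s * m₂) (htop _)
  refine isHyperbolicWeilType_prod_of_rationalModels φA _ hA' hB' hN u hur hui MA hMA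
    (Sum.elim (fun i => complexBetti.map (AbelianVariety.fst E E).hom.hom.hom 1 (x i))
      (fun i => complexBetti.map (AbelianVariety.snd E E).hom.hom.hom 1 (x i)))
    ?_ (linearIndependent_sumElim_map_fst_map_snd hxi hxi)
    (Matrix.fromBlocks (M.map (Int.cast : ℤ → ℚ)) 0 0 (-(M.map (Int.cast : ℤ → ℚ))))
    (map_prodLift_sumElim φ (-φ) x _ hMx x _ hnMx)
    (complexBetti.map eA.ι 2 aA) ωA GA hGA dA hdA _ _ _ hGB _ hdB b hb hbM ?_
  · rintro (i | i)
    · exact (hxr i).map _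
    · exact (hxr i).map _
  · intro k l
    refine Eq.trans (Finset.sum_congr rfl fun p _ => Finset.sum_congr rfl fun q _ => ?_) (hbG k l)
    congr 2
    rcases p with i | (j | j) <;> rcases q with i' | (j' | j') <;>
      simp only [Matrix.fromBlocks_apply₁₁, Matrix.fromBlocks_apply₁₂, Matrix.fromBlocks_apply₂₁,
        Matrix.fromBlocks_apply₂₂, Matrix.smul_apply, Matrix.zero_apply, smul_eq_mul, Nat.choose_zero_right,
        Nat.choose_self, Nat.choose_one_right, zero_add, Nat.cast_one, one_mul] <;> push_cast <;> ring

/-! ### The partner-surface fact, PROVED for every `n ≥ 1`, `d ≥ 1` -/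

/-- **The partner-surface fact of DESCENDING holds** (`exists_weilTypeSurface_prod_isHyperbolicWeilType_all`,
Markman arXiv:2509.23403 §11.5 Step 2 with Step 1; van Geemen LNM 1594 Lemma 5.2, 5.3, 5.4 (5.4.1);
Schoen 1998 §10 p. 333; Landherr): for `n, d ≥ 1` and a Weil-type `2n`-fold `(A₁, φ₁)` (a non-zero
rational `(n,n)`-class in `weilClassesOf A₁ φ₁ n d`), the CM square `A₂ = E × E`, `E = ℂ/(ℤ + ℤ√-d)`,
`φ₂ = ([√-d], -[√-d])` (`exists_cmWeilSurface_descentPair`, every `d`) is a Weil-type surface WITH ITS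
DESCENT PARTNER (`u± ∈ E±` by `eigenspace_le_weilClassesPlus/Minus_two`, both non-zero since
`u± ⌣ η ≠ 0`, `η` algebraic), and `A₁ × A₂` is of hyperbolic Weil type for the `K`-symmetrised
hyperplane class of a weighted Segre embedding (`aimedFrame_cmSquare`). Unconditional.
[cite: Markman2025SurveySecant, §11.5 Step 1 (last two sentences) and Step 2 (first two sentences)]
[cite: Schoen1998HodgeWeilAddendum, §10 (proof of the Proposition, p. 333)]
[cite: vanGeemen1994HodgeAV, Lemma 5.2 (1)–(6), 5.3–5.8 and 5.4 (5.4.1)] -/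
theorem exists_weilTypeSurface_prod_isHyperbolicWeilType_all_holds :
    Literature.AlgebraicGeometry.HodgeTheory.exists_weilTypeSurface_prod_isHyperbolicWeilType_all := by
  intro n hn d hd A₁ φ₁ hA₁ _hX₁ hφ₁ hc
  obtain ⟨E, φ, x, hE, hφ, hxr, hxi, _hxs, hM, _hadd, hω, _hH2, hBdim, hψ, bp, bm, η, hbp, hbm, hbrat, hb11,
    hη, hbpη, hbmη⟩ := exists_cmWeilSurface_descentPair d hd
  have hφ' : φ ≫ φ = -(d • 𝟙 E) := by rw [hφ, natCast_zsmul]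
  have hψ' : AbelianVariety.prodLift (AbelianVariety.fst E E ≫ φ) (AbelianVariety.snd E E ≫ (-φ)) ≫
      AbelianVariety.prodLift (AbelianVariety.fst E E ≫ φ) (AbelianVariety.snd E E ≫ (-φ)) =
        -(d • 𝟙 (E.prod E)) := by
    rw [hψ, natCast_zsmul]
  have hB2 : (E.prod E).dim = 2 * 1 := hBdim
  have hsp : IsSmoothProjective (2 * 1) (E.prod E).X := isSmoothProjective_of_dim_eq' hB2
  obtain ⟨e, a, ha, ha0, hhyp⟩ := aimedFrame_cmSquare hd E φ hE hφ' x _ hxr hxi hM hω hn hA₁ hφ₁ hc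
  refine ⟨E.prod E, _, hB2, hsp, hψ', ⟨bp, bm, eigenspace_le_weilClassesPlus_two hBdim hd hψ' hbp,
    eigenspace_le_weilClassesMinus_two hBdim hd hψ' hbm, hbrat, hb11, ?_, ?_, η, hη, hbpη, hbmη⟩,
    e, a, ha, ha0, hhyp⟩
  · intro h0
    apply hbpη
    rw [h0, LinearMap.map_zero₂]
  · intro h0
    apply hbmη
    rw [h0, LinearMap.map_zero₂]

/-! ### The stub, PROVED -/

/-- **DESCENDING (registered stub `stub_descend` of stmt-HodgeConjecture-1333, VERBATIM), proved for all
`n ≥ 2`, `d ≥ 1`**: if the Weil classes of every SPLIT Weil `2(n+1)`-fold in the hyperplane convention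
are algebraic (`Stubs.WeilAlgebraicSplitHyperplane (n + 1) d`), then so are those of EVERY Weil-type pair
of dimension `2n` with `φ ≫ φ = -d` (`WeilAlgebraicAll n d`) — Schoen's product trick (Compositio 114
(1998) §10; Koike 2004 Rem. 2.1; Markman arXiv:2509.23403 §11.5 Step 2): the landed assembly
`Stubs.Descend.stub_descend_of_partner_of_schoen` (p95682) fed with the partner-surface fact
(`exists_weilTypeSurface_prod_isHyperbolicWeilType_all_holds`, this file) and Schoen's transfer
(`Schoen1998_weilClasses_algebraic_of_prod_surface_all_holds`, tree). In particular (`(n, d) = (3, 3)`,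
this line's use): split `ℚ(√-3)` eightfolds give every `ℚ(√-3)` Weil sixfold.
[cite: Schoen1998HodgeWeilAddendum, §10 (Proposition and proof, pp. 332–333)]
[cite: Markman2025SurveySecant, §11.5 Step 2] [cite: Koike2004WeilHodge, Remark 2.1] -/
theorem stub_descend :
    ∀ n d : ℕ, 2 ≤ n → 0 < d → Stubs.WeilAlgebraicSplitHyperplane (n + 1) d → WeilAlgebraicAll n d :=
  EStepSecantInduction.Stubs.Descend.stub_descend_of_partner_of_schoen
    exists_weilTypeSurface_prod_isHyperbolicWeilType_all_holds
    Schoen1998_weilClasses_algebraic_of_prod_surface_all_holds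

/-- The instance this line consumes (`weilAlgebraicAll_three_three_of`): **split `ℚ(√-3)` eightfolds give
every `ℚ(√-3)` Weil SIXFOLD, every discriminant** — `stub_descend` at `(n, d) = (3, 3)`.
[cite: Schoen1998HodgeWeilAddendum, §10 (Proposition and proof, pp. 332–333)] -/
theorem descend_three_three : Stubs.WeilAlgebraicSplitHyperplane 4 3 → WeilAlgebraicAll 3 3 :=
  stub_descend 3 3 (by norm_num) (by norm_num)

end Summit.HodgeConjecture.HodgeConjecture.Cruxes.HodgeAbelianVarieties.PrymCanonicalZ3SplitSeeds.Stubs.Descend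

end
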